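import Literature.NumberTheory.LFunctions.ZeroGaps
import HarnessLib

/-!
# Explicit constants for small gaps between consecutive zeros of `ζ`: the unconditional record

Trunk T-ANT (`Literature/NumberTheory/LFunctions`). Named facts (D-0014; `def … : Prop`, nothing
asserted) recording the only EXPLICIT UNCONDITIONAL small-gap theorems in print, written in the
vocabulary of `ZeroGaps.lean` (`zetaOrdinate`, `zetaZeroCount`, `zetaNormalizedGap`; ordinates
`0 < γ_0 ≤ γ_1 ≤ ⋯` of ALL non-trivial zeros, repeated with multiplicity), and the one-line
comparison with the inexplicit Selberg–Fujii fact `selberg_fujii_small_gaps` of that file.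

## What is known (literature query `rh-unconditional-small-gaps`, 2026-08-16)

Write `δ_n = (γ_{n+1} − γ_n)/(2π/log γ_n)` (`zetaNormalizedGap n`), `μ = lim inf δ_n`, and call a
bound `θ` a *proportion bound* when `δ_n ≤ θ` holds for at least `A · N(T)` indices `n < N(T)`,
`T ≥ T₀`. Three methods exist (Goldston–Trudgian–Turnage-Butterbaugh 2023, §1; Bui–Goldston–
Milinovich–Montgomery 2023, §1): Montgomery–Odlyzko / Conrey–Ghosh–Gonek (needs RH), Montgomery's
pair correlation (needs RH), and Selberg's moments of `S(t+h) − S(t)` (unconditional).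

* UNCONDITIONAL, inexplicit: some `θ < 1` as a proportion bound — Selberg (announced 1946/47),
  Fujii (1975), proof by Heath-Brown in Titchmarsh (2nd ed.) §9.26; in the tree:
  `selberg_fujii_small_gaps`.
  For `r`-gaps, `lim inf (γ_{n+r} − γ_n)/(2πr/log γ_n) < 1 − θ₂ r^{-2/3}` (Inoue 2024, Thm. 1).
* UNCONDITIONAL, explicit: `θ = 1 − 10^{-3·10^{13}}` as a proportion bound
  (Simonič–Trudgian–Turnage-Butterbaugh, Trans. AMS 375 (2022), Thm. 1: `μ₀ < 1 − 2c₀c₁/(1 − 2c₁)`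
  with `c₀ = π e^{4.3}/exp(exp(30.76))`; §2.3: even with all error terms removed the method cannot
  pass `λ < 1.1286` on the large-gap side, and the small-gap constant is slaved to it) —
  `stt_explicit_small_gaps` below; and `θ = 1 − 9.23·10^{-7}` as a proportion bound, with the
  explicit density `D⁻(1 − 9·10^{-7}, 1) > 2·10^{-42}` on dyadic windows (Zhao, arXiv:2603.17334
  (2026), Thm. 2 and §6.2.1, PREPRINT) — `zhao_small_gap_density` below.
* ON RH (not recorded as facts here): `μ ≤ 0.515396` (Preobrazhenskiĭ 2016; the Montgomery–Odlyzko
  method cannot reach `0.5042`, Goldston–Trudgian–Turnage-Butterbaugh 2023, Thm. 1); proportion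
  bounds `0.77` (Conrey–Ghosh–Goldston–Gonek–Heath-Brown 1985), `0.6876` (Soundararajan 1996),
  `0.6553` (Wu 2014), `0.6039` (Bui–Goldston–Milinovich–Montgomery 2023, Thm. 1); DISTINCT zeros
  `μ_d ≤ 0.991` for `≫ T^{1−ε}` pairs, not a positive proportion (ibid., Thm. 2).

So no unconditional bound `θ < 0.90` (indeed none below `1 − 10^{-6}`) is known. All results above
concern SPACINGS of the multiset of ordinates: none excludes that the small spacings found are
multiple zeros (or, unconditionally, pairs `ρ`, `1 − ρ̄` off the line sharing an ordinate), except
the RH result on `μ_d` (Bui–Goldston–Milinovich–Montgomery 2023, §1).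

## Design choices

* `stt_explicit_small_gaps` has literally the shape of `selberg_fujii_small_gaps` with the
  witness `μ = 1 − 10^{-3·10^{13}}` (written `1 - 1 / 10 ^ (3 * 10 ^ 13)`, a real power with a
  natural exponent; never unfold it numerically). It is the CONSEQUENCE form of Thm. 1 of the paper:
  there `D(μ, T) = N(T)⁻¹ #{0 < γ_n ≤ T : γ_{n+1} − γ_n ≤ 2πμ/log T}` and
  `lim inf_T D(μ, T) > c₂ > 0`;
  since `0 < log γ_n ≤ log T` for `γ_n ≤ T` (`γ_0 > 14`), `γ_{n+1} − γ_n ≤ 2πμ/log T` gives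
  `δ_n ≤ μ log γ_n/log T ≤ μ`, and `{n | 0 < γ_n ≤ T} = {n | n < N(T)}` (module docstring of
  `ZeroGaps.lean`). That `μ = 1 − 10^{-3·10^{13}}` is admissible in Thm. 1 is the paper's own
  evaluation as quoted by Zhao (2026, (1.4)) and by Bui–Goldston–Milinovich–Montgomery (2023, §1).
* `zhao_small_gap_density` keeps the paper's dyadic-window density `D(μ, 1, T)` verbatim
  (window `T ≤ γ_n ≤ 2T`, threshold `2πμ/log T`, denominator `N(2T) − N(T)`), with the strict
  `lim inf > 2·10^{-42}` weakened to "`≥ 2·10^{-42}` for `T ≥ T₀`". The paper counts a zero of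
  ordinate exactly `t` with weight `1/2` in `N(t)`; this changes numerator and denominator by
  `O(log T) = o(N(2T) − N(T))`, which the strict inequality absorbs. It is a PREPRINT claim
  (`[claim: …, status: under-review]`), kept separate from the refereed fact on purpose.
* Nothing is asserted; users take `(h : stt_explicit_small_gaps)`. The only theorem is the
  bookkeeping implication to `selberg_fujii_small_gaps`.

## References

* A. Simonič, T. S. Trudgian, C. L. Turnage-Butterbaugh, *Some explicit and unconditional results on
  gaps between zeroes of the Riemann zeta-function*, Trans. Amer. Math. Soc. 375 (2022), 3239–3265,
  Thm. 1, §§2.2–2.3. [key `SimonicTrudgianTurnageButterbaugh2022`]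
* T. Zhao, *Density results for r-gaps between zeros of the Riemann zeta-function*,
  arXiv:2603.17334 (2026), Thms. 1–2, §6.2.1. [key `Zhao2026ZetaGaps`]
* E. C. Titchmarsh, *The Theory of the Riemann Zeta-Function*, 2nd ed. (D. R. Heath-Brown), 1986,
  §9.25 (9.25.6), §9.26. [key `Titchmarsh1986`]
* S. Inoue, Bull. Lond. Math. Soc. 56 (2024), 2268–2277, Thm. 1. [key `Inoue2024ZetaGaps`]
* D. A. Goldston, T. S. Trudgian, C. L. Turnage-Butterbaugh, J. Math. Anal. Appl. 527 (2023),
  127548, §1 and Thm. 1. [key `GoldstonTrudgianTurnageButterbaugh2023`]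
* H. M. Bui, D. A. Goldston, M. B. Milinovich, H. L. Montgomery, Acta Arith. 210 (2023), 133–153,
  §1, Thms. 1–2. [key `BuiEtAl2023`]
* J. B. Conrey, A. Ghosh, D. Goldston, S. M. Gonek, D. R. Heath-Brown, Quart. J. Math. Oxford (2)
  36 (1985), 43–51. [key `ConreyEtAl1985`]
-/

noncomputable section

open Real

namespace Literature.NumberTheory.LFunctions

/-- NAMED FACT (Simonič–Trudgian–Turnage-Butterbaugh 2022, Thm. 1, small-gap half, consequence
form; the first explicit unconditional constant). There are `A > 0` and `T₀` such that for every
`T ≥ T₀` at least `A · N(T)` indices `n < N(T)` (i.e. `0 < γ_n ≤ T`) have normalised gap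
`δ_n = (γ_{n+1} − γ_n)/(2π/log γ_n) ≤ 1 − 10^{-3·10^{13}}`: a positive proportion of consecutive
ordinates of the zeros of `ζ` (all non-trivial zeros, with multiplicity) are closer than
`1 − 10^{-3·10^{13}}` mean spacings. Unconditional (no RH). The paper's Thm. 1 reads
`D⁻(μ) > c₂` for `μ > 1 − 2c₀c₁/(1 − 2c₁)`, `c₀ = π e^{4.3}/exp(exp(30.76))`,
`c₁ = (1 + c₀ − λ)²/(16 e^{99.8})`, `c₂ = ((1 − 2c₁)μ + 2λc₁ − 1)/(2μ)`, any `1 ≤ λ < 1 + c₀`; the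
value `μ = 1 − 10^{-3·10^{13}}` and the passage to `δ_n ≤ μ` are explained in the module docstring.
Users take `(h : stt_explicit_small_gaps)`.
[cite: SimonicTrudgianTurnageButterbaugh2022, Thm. 1 and §2.2] -/
def stt_explicit_small_gaps : Prop :=
  ∃ A : ℝ, 0 < A ∧ ∃ T₀ : ℝ, ∀ T : ℝ, T₀ ≤ T →
    A * (zetaZeroCount T : ℝ) ≤
      (((Finset.range (zetaZeroCount T)).filter fun n ↦
          zetaNormalizedGap n ≤ 1 - 1 / 10 ^ (3 * 10 ^ 13)).card : ℝ)

/-- CLAIMED FACT (Zhao 2026, preprint arXiv:2603.17334, Thm. 2 with §6.2.1, case `r = 1`,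
unconditional half). For all large `T`, at least `2·10^{-42} · (N(2T) − N(T))` indices `n` with
`T ≤ γ_n ≤ 2T` satisfy `γ_{n+1} − γ_n ≤ 2π(1 − 9·10^{-7})/log T`: in every dyadic window a
proportion `≥ 2·10^{-42}` of consecutive ordinates are within `1 − 9·10^{-7}` mean spacings
(`D⁻(1 − 9·10^{-7}, 1) > 2·10^{-42}` in the paper's notation; Thm. 2 gives the threshold
`1 − 9.23·10^{-7}` with an unspecified positive density). Indices with `T ≤ γ_n ≤ 2T` are the
`n < N(2T)` with `T ≤ γ_n`. Unconditional; `T₀` not computed in the source. UNREFEREED (v1, March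
2026): kept as a claim, separate from `stt_explicit_small_gaps`. Users take
`(h : zhao_small_gap_density)`. Locator: arXiv:2603.17334v1, Thm. 2 and §6.2.1.
[claim: Zhao2026ZetaGaps, status: under-review] -/
def zhao_small_gap_density : Prop :=
  ∃ T₀ : ℝ, ∀ T : ℝ, T₀ ≤ T →
    2 / 10 ^ 42 * ((zetaZeroCount (2 * T) : ℝ) - zetaZeroCount T) ≤
      (((Finset.range (zetaZeroCount (2 * T))).filter fun n ↦
          T ≤ zetaOrdinate n ∧
            zetaOrdinate (n + 1) - zetaOrdinate n ≤ 2 * π * (1 - 9 / 10 ^ 7) / Real.log T).card : ℝ)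

/-- The explicit threshold `1 − 10^{-3·10^{13}}` is `< 1` (structural: `10^k > 0`; the numeral is
never evaluated). [folklore] -/
theorem stt_threshold_lt_one : (1 : ℝ) - 1 / 10 ^ (3 * 10 ^ 13) < 1 :=
  sub_lt_self 1 (by positivity)

/-- Bookkeeping: the explicit fact of Simonič–Trudgian–Turnage-Butterbaugh implies the inexplicit
Selberg–Fujii fact `selberg_fujii_small_gaps` (Titchmarsh (9.25.6)), with witness
`μ = 1 − 10^{-3·10^{13}}`. [folklore] -/
theorem selberg_fujii_small_gaps_of_stt (h : stt_explicit_small_gaps) :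
    selberg_fujii_small_gaps :=
  ⟨1 - 1 / 10 ^ (3 * 10 ^ 13), stt_threshold_lt_one, h⟩

end Literature.NumberTheory.LFunctions

end
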